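import Literature.Geometry.Lorentzian.EventHorizonGenerators
import Literature.Geometry.Lorentzian.EventHorizonAreaLaw
import Literature.Geometry.Lorentzian.AchronalBoundaryProofs
import HarnessLib

/-!
# The area law for the event horizon of a vacuum Cauchy development, given only complete generators
(Hawking–Ellis 1973, Prop. 9.2.7; Chruściel–Delay–Galloway–Howard 2001, Thm. 1.1 (b))

`EventHorizonAreaLaw.lean` renders Hawking's area theorem for the intrinsic event horizon
`𝓗⁺ = 𝒟.futureEventHorizon` of a (vacuum) Cauchy development from the named fact
`ChruscielEtAl2001_areaTheorem`, leaving as hypotheses on `𝓗⁺` the achronal-boundary property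
(discharged: `HawkingEllis1973_achronalBoundary_holds`) and
`hgen : 𝒟.toSpacetime.IsRuledByCompleteNullGeodesics 𝓗⁺` — "through every point of `𝓗⁺` passes a
future-COMPLETE null geodesic ray staying in `𝓗⁺`". That hypothesis mixes a theorem with an assumption:
THAT `𝓗⁺` is ruled by null geodesic generators which never leave it to the future is causal theory
(Hawking–Ellis 1973, §9.2, p. 319; `CauchyDevelopment.isFutureNullGeodesicallyRuled_futureEventHorizon` of
`EventHorizonGenerators.lean`), while COMPLETENESS of the generators is the physical input
(`LorentzianMetric.HasFutureCompleteGenerators`, hypothesis (b) of CDGH Thm. 1.1, a weak-cosmic-censorship-type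
statement). This file separates the two:

* `CauchyDevelopment.isRuledByCompleteNullGeodesics_futureEventHorizon_of_hasFutureCompleteGenerators` — for a
  Cauchy development, `HasFutureCompleteGenerators 𝓗⁺ → IsRuledByCompleteNullGeodesics 𝓗⁺`;
* `VacuumCauchyDevelopment.monotone_horizonArea_of_hasFutureCompleteGenerators` — **Hawking's area theorem
  along every advanced-time foliation of `𝓗⁺ ∩ J⁺(ι X)`, from the single named fact
  `ChruscielEtAl2001_areaTheorem` and the single physical hypothesis "the generators of `𝓗⁺` are future
  complete"** (vacuum gives the null energy condition; the achronal-boundary and ruling properties are theorems).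

No definitions, no new named facts. (Data manifolds in `Type`, as in the summit statements.)

## References

* S. W. Hawking, G. F. R. Ellis, *The large scale structure of space-time*, CUP 1973, §9.2, p. 319 and
  Prop. 9.2.7. [HawkingEllis1973CUP]
* P. T. Chruściel, E. Delay, G. J. Galloway, R. Howard, *Regularity of horizons and the area theorem*,
  Ann. Henri Poincaré 2 (2001) 109–178, Thm. 1.1. [ChruscielEtAl2001]
-/

noncomputable section

open Set Filter Function
open scoped Manifold ContDiff Topology

namespace Literature.Geometry.Lorentzian

variable {n : ℕ} {X : Type} [TopologicalSpace X] [ChartedSpace (EuclideanSpace ℝ (Fin n)) X]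
  [IsManifold (𝓡 n) ∞ X] [ConnectedSpace X] {D : InitialDataSet (𝓡 n) X}

namespace CauchyDevelopment

/-- **Complete generators make the event horizon "ruled by complete null geodesics"** in the sense of
the area theorem's hypothesis `Spacetime.IsRuledByCompleteNullGeodesics`: the generator through `p`
(`isFutureNullGeodesicallyRuled_futureEventHorizon`) has affine domain unbounded above by
`HasFutureCompleteGenerators`, so it is an affinely parametrised null geodesic on `[t₀, ∞)` staying in `𝓗⁺`,
with future-directed null velocity throughout (propagation along the geodesic).
[cite: ChruscielEtAl2001, §2 and Thm. 1.1 (b)] -/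
theorem isRuledByCompleteNullGeodesics_futureEventHorizon_of_hasFutureCompleteGenerators
    (𝒟 : CauchyDevelopment D) [𝒟.metric.HasLeviCivita]
    (hc : 𝒟.metric.HasFutureCompleteGenerators 𝒟.timeOrientation 𝒟.futureEventHorizon) :
    𝒟.toSpacetime.IsRuledByCompleteNullGeodesics 𝒟.futureEventHorizon := by
  haveI := LorentzianMetric.contMDiffCovariantDerivative_leviCivita_one 𝒟.metric
  haveI : Fact ((1 : ℕ∞ω) ≤ ∞) := ⟨WithTop.coe_le_coe.mpr le_top⟩
  intro p hp
  obtain ⟨μ, dom, t₀, hmax, ht₀, hμt₀, hnull, hfd, hstay⟩ :=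
    𝒟.isFutureNullGeodesicallyRuled_futureEventHorizon p hp
  have hunb : ¬ BddAbove dom := hc μ dom t₀ hmax ht₀ hnull hfd hstay
  have hIci : Ici t₀ ⊆ dom := fun s hs ↦ by
    obtain ⟨s', hs', hss'⟩ := not_bddAbove_iff.1 hunb s
    exact hmax.2.1.out ht₀ hs' ⟨hs, hss'.le⟩
  refine ⟨μ, t₀, t₀, le_rfl, hμt₀, hmax.isGeodesicOn.mono hIci, fun t ht ↦ ?_,
    fun t ht ↦ hstay t (hIci ht) ht⟩
  exact IsGeodesicOn.isNull_and_isFutureDirected_velocity 𝒟.metric 𝒟.timeOrientation hmax.1 hmax.2.1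
    hmax.isGeodesicOn ht₀ hnull hfd (hIci ht)

end CauchyDevelopment

/-- **Hawking's area theorem for a vacuum Cauchy development, given only complete generators.** Let `𝒟`
be a vacuum Cauchy development of `3`-dimensional data and `A` an advanced-time foliation of
`𝓗⁺ ∩ J⁺(ι X) = 𝒟.eventHorizonOf 𝒟.completeNullRayRegion` (`EventHorizonArea`). If the null geodesic
generators of the intrinsic event horizon `𝓗⁺ = 𝒟.futureEventHorizon` are future complete
(`HasFutureCompleteGenerators`), then — from the named fact `ChruscielEtAl2001_areaTheorem` alone — the
horizon area `v ↦ A.horizonArea v` is monotone. The other hypotheses of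
`VacuumCauchyDevelopment.monotone_horizonArea_of_achronalBoundary` are theorems: the achronal-boundary
property (`HawkingEllis1973_achronalBoundary_holds`) and the ruling of `𝓗⁺` by its generators
(`isRuledByCompleteNullGeodesics_futureEventHorizon_of_hasFutureCompleteGenerators`). Hawking–Ellis 1973,
Prop. 9.2.7 ("the area of the boundary of a black hole cannot decrease with time").
[cite: ChruscielEtAl2001, Thm. 1.1 (b)] [cite: HawkingEllis1973CUP, §9.2, Prop. 9.2.7] -/
theorem VacuumCauchyDevelopment.monotone_horizonArea_of_hasFutureCompleteGenerators
    {X : Type} [TopologicalSpace X] [ChartedSpace E3 X] [IsManifold (𝓡 3) ∞ X] [ConnectedSpace X]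
    {D : InitialDataSet (𝓡 3) X} (hAT : ChruscielEtAl2001_areaTheorem.{0})
    (𝒟 : VacuumCauchyDevelopment D) [𝒟.metric.HasLeviCivita]
    (A : EventHorizonArea 𝒟.toCauchyDevelopment 𝒟.completeNullRayRegion)
    (hc : 𝒟.metric.HasFutureCompleteGenerators 𝒟.timeOrientation 𝒟.futureEventHorizon) :
    Monotone A.horizonArea :=
  𝒟.monotone_horizonArea_of_achronalBoundary hAT HawkingEllis1973_achronalBoundary_holds A
    (𝒟.toCauchyDevelopment.isRuledByCompleteNullGeodesics_futureEventHorizon_of_hasFutureCompleteGenerators hc)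

end Literature.Geometry.Lorentzian

end
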